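import Literature.NumberTheory.EllipticCurves.SelmerGaloisAction
import HarnessLib

/-!
# Crux V2♭θ `KolyvaginCorankLowerBoundAtTwoTheta` (stmt-BirchSwinnertonDyer-27220), line
# `kolyvagin_depth_split`, inside of S1: a Weil datum equivariant under ONE lift of `τ` is equivariant
# under EVERY lift (helper, PROVED; seat `bsd-line-krr2-p2` g7)

The S1 frame carries a Weil pairing datum `e` on `E[n](K̄)` that is `Γ_K`-equivariant (`hgal`) and
equivariant under the chosen lift `liftAut τ` of the non-trivial automorphism `τ` of `K` (`hτe`); the local
pieces at a `τ`-fixed place `v` (this seat's P5 local/global files, `map_weilDual_conjActPlace`) want the same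
equivariance for the ADAPTED lift `liftAutPlace τ hfix`.  Two lifts of `τ` differ by an element `γ` of `Γ_K`
(`IsLiftOfAut.divGal`, `IsLiftOfAut.torsionMap_eq_comp`), and `e` is `γ`-equivariant, so the property
transfers: `weil_equivariant_of_isLiftOfAut`.  HONEST FRAMING: helper (`--supports` 27220); pure bookkeeping;
S1 / V2♭θ are NOT proved; BSD is not proved.

References: [cite: SilvermanAEC2009, Prop. III.8.1 (d)] [cite: SerreLocalFields1979, VII.§5 Prop. 3].
-/

set_option autoImplicit false
set_option linter.dupNamespace false

noncomputable section

open scoped Classical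
open WeierstrassCurve Field
open Literature.NumberTheory.EllipticCurves Literature.NumberTheory.GaloisRepresentations

namespace Summit.BirchSwinnertonDyer.BirchSwinnertonDyer.Theorems.KolyvaginLowerBoundAtTwo

universe u

variable {K : Type u} [Field K] [NumberField K] (W : WeierstrassCurve ℚ) {σ : K ≃ₐ[ℚ] K} (n : ℤ)
  {τ₁ τ₂ : AlgebraicClosure K ≃+* AlgebraicClosure K}

/-- **Equivariance of a `Γ_K`-equivariant pairing datum under one lift of `σ` implies equivariance under
any other lift.**  For `e : E[n] × E[n] → K̄` with `g • e S T = e (g • S) (g • T)` (`g ∈ Γ_K`) and lifts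
`τ₁, τ₂` of `σ`: if `τ₂ (e S T) = e (τ₂ S) (τ₂ T)` then `τ₁ (e S T) = e (τ₁ S) (τ₁ T)` (`τ₁ = τ₂ ∘ γ` with
`γ = τ₂⁻¹ τ₁ ∈ Γ_K`, `IsLiftOfAut.divGal`, `IsLiftOfAut.torsionMap_eq_comp`).
[cite: SilvermanAEC2009, Prop. III.8.1 (d)] [cite: SerreLocalFields1979, VII.§5 Prop. 3] -/
theorem weil_equivariant_of_isLiftOfAut (hτ₁ : IsLiftOfAut σ τ₁) (hτ₂ : IsLiftOfAut σ τ₂)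
    (e : geomTorsion (W.baseChange K) n → geomTorsion (W.baseChange K) n → AlgebraicClosure K)
    (hgal : ∀ (g : absoluteGaloisGroup K) (S T : geomTorsion (W.baseChange K) n),
      g • e S T = e (g • S) (g • T))
    (h₂ : ∀ S T, τ₂ (e S T) = e (hτ₂.torsionMap W n S) (hτ₂.torsionMap W n T)) (S T : geomTorsion (W.baseChange K) n) :
    τ₁ (e S T) = e (hτ₁.torsionMap W n S) (hτ₁.torsionMap W n T) := by
  have hdiv : ∀ x : AlgebraicClosure K, τ₁ x = τ₂ ((hτ₁.divGal hτ₂) • x) := fun x => by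
    rw [Field.absoluteGaloisGroup.smul_def]
    change τ₁ x = τ₂ ((show AlgebraicClosure K ≃ₐ[K] AlgebraicClosure K from hτ₁.divGal hτ₂) x)
    rw [IsLiftOfAut.divGal_apply, RingEquiv.apply_symm_apply]
  rw [hdiv, hgal, h₂, IsLiftOfAut.torsionMap_eq_comp W hτ₁ hτ₂ n]
  rfl

end Summit.BirchSwinnertonDyer.BirchSwinnertonDyer.Theorems.KolyvaginLowerBoundAtTwo

end
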